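import Summits.AnomalousDissipation.AnomalousDissipation.Theorems.BaireTransferRobustLoudUpgradeStubBorderedFamily
import Summits.AnomalousDissipation.AnomalousDissipation.Theorems.DenseLoudDesignerForces.Negative.Scaling

/-!
# Line `malkin-cone-group-orbits`, companion c4 ("the viscosity unfolding"): loudness is scale-covariant
# (crux `BaireTransfer.RobustLoudUpgrade`, stmt-AnomalousDissipation-1144)

Registered sub-goal `scaling_mem_loud` of the companion skeleton c4, proved here, plus the elementary choice of a
scaling margin used by both scaling-crossing engines.

The parabolic scaling `(u, p, ν, f) ↦ (αu(α·), α²p(α·), αν, α²f)` maps `τ`-periodic classical orbits of `NS_ν(f_c)` to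
`τ/α`-periodic classical orbits of `NS_{αν}(f_{α²c})` with `meanEnergy ↦ α²·`, `meanDissipation ↦ α³·` (landed for the
sibling crux: `DenseLoudDesignerForces.Negative.timeRescale`, `meanEnergy_timeRescale`, `meanDissipation_timeRescale`;
linearity `BorderedFamily.force_smul'`).  Hence a loud coefficient vector at level `a'` and budgets `(E', ε')` rescales to
a loud vector `α² • c` at any level `a ≥ αa'` and budgets `E ≥ α²E'`, `ε ≤ α³ε'` (`scaling_mem_loud`).  Since the level,
the energy and the dissipation move by the factors `α, α², α³`, a witness with STRICT slack absorbs every `α` close to `1`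
(`exists_scale_margin`, stated for `α = (√s)⁻¹`, the factor undoing a dilation `c ↦ s • c` of the force).

References: the route file (item 1144); `Cruxes/RobustLoudUpgrade/Disproof.lean` §9 ("level is decoration");
`Theorems/DenseLoudDesignerForces/Negative/Scaling.lean`.
-/

-- `Summit.<Summit>.<Problem>` is the tree's mandated summit-side namespace (CONVENTIONS §2); for this
-- single-conjunct summit the two coincide, so the duplicate is deliberate.
set_option linter.dupNamespace false

noncomputable section

open scoped BigOperators Topology
open Filter Set Function TopologicalSpace MeasureTheory

namespace Summit.AnomalousDissipation.AnomalousDissipation.Theorems.RobustLoudUpgrade.Scaling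

open Literature.Analysis.FunctionSpaces Literature.Analysis.FunctionSpaces.Torus
open Literature.Analysis.FluidPDE
open Summit.AnomalousDissipation.AnomalousDissipation.Theses.BaireTransfer
open Summit.AnomalousDissipation.AnomalousDissipation.Theorems.RobustLoudUpgrade

/-! ## Loudness is scale-covariant -/

/-- **Registered sub-goal `scaling_mem_loud`: rescaling a loud coefficient vector.**  If `c ∈ LOUD^{(0,a')}(S,E',ε')`
then `α² • c ∈ LOUD^{(0,a)}(S,E,ε)` whenever `0 < α`, `αa' ≤ a`, `α²E' ≤ E` and `ε ≤ α³ε'`: the witness `(u, p)` at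
viscosity `ν < a'` is replaced by `(αu(α·), α²p(α·))` at viscosity `αν < a`, forced by `α²f_c = f_{α²c}`, with period
`τ/α`, mean energy `α²⟨‖u‖²⟩ ≤ α²E' ≤ E` and mean dissipation `α³⟨ν‖∇u‖²⟩ ≥ α³ε' ≥ ε`. [folklore] -/
theorem scaling_mem_loud : ∀ (S : Finset (Fin 3 → ℤ)) (a a' E E' ε ε' α : ℝ) (c : Coeff S), c ∈ loud S a' E' ε' → 0 < α → α * a' ≤ a → α ^ 2 * E' ≤ E → ε ≤ α ^ 3 * ε' → α ^ 2 • c ∈ loud S a E ε := by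
  intro S a a' E E' ε ε' α c hc hα hαa hE hε
  obtain ⟨ν, hν, hνa', τ, u, p, hτ, hsol, hper, hEu, hεu⟩ := hc
  refine ⟨α * ν, mul_pos hα hν, lt_of_lt_of_le (mul_lt_mul_of_pos_left hνa' hα) hαa, τ / α,
    fun t x => α • u (α * t) x, fun t x => α ^ 2 * p (α * t) x, div_pos hτ hα, ?_,
    DenseLoudDesignerForces.Negative.periodic_timeRescale hper hα.ne', ?_, ?_⟩
  · -- the rescaled pair solves `NS_{αν}` with force `α² f_c = f_{α² c}`
    have h := DenseLoudDesignerForces.Negative.timeRescale hsol α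
    rwa [← BorderedFamily.force_smul'] at h
  · rw [DenseLoudDesignerForces.Negative.meanEnergy_timeRescale hper hτ hα]
    exact (mul_le_mul_of_nonneg_left hEu (sq_nonneg α)).trans hE
  · rw [DenseLoudDesignerForces.Negative.meanDissipation_timeRescale hsol.smooth_velocity hper hτ hα]
    exact hε.trans (mul_le_mul_of_nonneg_left hεu (pow_nonneg hα.le 3))

/-! ## The scaling margin of a strict witness -/

/-- Undoing a dilation: for `0 < s`, `α := (√s)⁻¹` satisfies `α² s = 1`. [folklore] -/
theorem inv_sqrt_sq_mul {s : ℝ} (hs : 0 < s) : (Real.sqrt s)⁻¹ ^ 2 * s = 1 := by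
  rw [inv_pow, Real.sq_sqrt hs.le, inv_mul_cancel₀ hs.ne']

/-- Undoing a dilation, vector form: `(√s)⁻² • (s • c) = c`. [folklore] -/
theorem inv_sqrt_sq_smul_smul {V : Type*} [AddCommGroup V] [Module ℝ V] {s : ℝ} (hs : 0 < s) (c : V) :
    (Real.sqrt s)⁻¹ ^ 2 • s • c = c := by
  rw [smul_smul, inv_sqrt_sq_mul hs, one_smul]

/-- **The scaling margin.**  Given a level `ν < a` and STRICT budget bounds `X < E`, `ε < Y`, there is `κ > 0` such
that for every dilation factor `s` with `|s − 1| < κ` the undoing factor `α = (√s)⁻¹` satisfies `0 < α`, `αν < a`,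
`α²X < E` and `ε < α³Y` (continuity of `s ↦ (√s)⁻¹` at `1`). [folklore] -/
theorem exists_scale_margin {ν a X E ε Y : ℝ} (hνa : ν < a) (hXE : X < E) (hεY : ε < Y) :
    ∃ κ : ℝ, 0 < κ ∧ ∀ s : ℝ, |s - 1| < κ →
      0 < s ∧ 0 < (Real.sqrt s)⁻¹ ∧ (Real.sqrt s)⁻¹ * ν < a ∧ (Real.sqrt s)⁻¹ ^ 2 * X < E ∧
        ε < (Real.sqrt s)⁻¹ ^ 3 * Y := by
  set φ : ℝ → ℝ := fun s => (Real.sqrt s)⁻¹ with hφ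
  have hφ1 : φ 1 = 1 := by simp [hφ]
  have hcont : ContinuousAt φ 1 :=
    (Real.continuous_sqrt.continuousAt).inv₀ (by simp)
  have ht : Tendsto φ (𝓝 1) (𝓝 1) := by simpa [hφ1] using hcont.tendsto
  have h0 : ∀ᶠ s : ℝ in 𝓝 1, 0 < s := eventually_gt_nhds one_pos
  have h1 : ∀ᶠ s : ℝ in 𝓝 1, 0 < φ s := ht.eventually_const_lt one_pos
  have h2 : ∀ᶠ s : ℝ in 𝓝 1, φ s * ν < a :=
    (ht.mul_const ν).eventually_lt_const (by simpa using hνa)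
  have h3 : ∀ᶠ s : ℝ in 𝓝 1, φ s ^ 2 * X < E :=
    ((ht.pow 2).mul_const X).eventually_lt_const (by simpa using hXE)
  have h4 : ∀ᶠ s : ℝ in 𝓝 1, ε < φ s ^ 3 * Y :=
    ((ht.pow 3).mul_const Y).eventually_const_lt (by simpa using hεY)
  obtain ⟨κ, hκ, hall⟩ := Metric.eventually_nhds_iff.1 ((((h0.and h1).and h2).and h3).and h4)
  refine ⟨κ, hκ, fun s hs => ?_⟩
  have hs' : dist s 1 < κ := by rwa [Real.dist_eq]
  obtain ⟨⟨⟨⟨e0, e1⟩, e2⟩, e3⟩, e4⟩ := hall hs'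
  exact ⟨e0, e1, e2, e3, e4⟩

end Summit.AnomalousDissipation.AnomalousDissipation.Theorems.RobustLoudUpgrade.Scaling

end
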